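import Literature.AlgebraicGeometry.Motives.GrassmannianSchemeOpenCover
import Mathlib.AlgebraicGeometry.Morphisms.FiniteType
import Mathlib.AlgebraicGeometry.Limits
import HarnessLib

/-!
# The Grassmannian scheme is locally of finite type over `ℤ`

Topic `Literature/AlgebraicGeometry/Motives`; namespace `Literature.AlgebraicGeometry.Motives.Grassmannian`.  Sequel to
`GrassmannianSchemeOpenCover` (cell hodgecm-mathlib key (h4); B-p18 (g17)).  THEOREMS ONLY.

The standard open cover ★ `chartOpenCover` of `grassmannianScheme M k` consists of the affine spaces `Spec ℤ[X_p : p ∈ (J ∖ I) × Fin k]`;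
when the basis index type `J` is finite these are of finite type over `ℤ`, and «locally of finite type» is local on the source
(Mathlib `IsZariskiLocalAtSource`, `HasRingHomProperty @LocallyOfFiniteType RingHom.FiniteType`).  Hence:

* `locallyOfFiniteType_to_specULiftZ_chartScheme` — `Spec ℤ[X_I] ⟶ Spec ℤ` is locally of finite type (`J` finite);
* **`locallyOfFiniteType_grassmannianScheme`** — `grassmannianScheme M k ⟶ Spec ℤ` (the unique morphism to the terminal scheme
  `Spec (ULift ℤ)`) is locally of finite type, for `M` with a finite basis; `…_of_finite` — the `[Module.Free ℤ M] [Module.Finite ℤ M]` form;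
* **`compactSpace_grassmannianScheme`** (`…_of_finite`) — the Grassmannian scheme is quasi-compact (finitely many affine charts), so it is
  OF FINITE TYPE over `ℤ`.

[Stacks 089T] («`G(k,n)` is smooth (hence of finite type) over `ℤ`, being covered by affine spaces»); [GortzWedhorn2020, (8.4), Cor. 8.15].
HC_CM is proved only modulo the 7 printed citations until rung 0 closes; nothing here is about HC.
-/

noncomputable section

namespace Literature.AlgebraicGeometry.Motives.Grassmannian

open CategoryTheory Opposite TensorProduct _root_.AlgebraicGeometry

universe u

section Chart

variable (k : ℕ) {J : Type u}

/-- **The chart scheme `Spec ℤ[X_I]` is locally of finite type over `ℤ`** (finitely many variables when `J` is finite): any morphism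
`chartScheme k I ⟶ Spec (ULift ℤ)` (there is exactly one) is `Spec` of the structure map `ULift ℤ → ℤ[X_I]`, a finite-type ring map.
[cite: StacksProject, Tag 089T] -/
theorem locallyOfFiniteType_to_specULiftZ_chartScheme [Finite J] (I : Fin k → J)
    (g : chartScheme k I ⟶ Spec (CommRingCat.of (ULift.{u} ℤ))) : LocallyOfFiniteType g := by
  let P := MvPolynomial ({j : J // j ∉ Set.range I} × Fin k) ℤ
  let φ : CommRingCat.of (ULift.{u} ℤ) ⟶ chartRing k I :=
    CommRingCat.ofHom ((algebraMap ℤ P).comp ULift.ringEquiv.toRingHom)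
  have hg : g = Spec.map φ := specULiftZIsTerminal.hom_ext _ _
  rw [hg, HasRingHomProperty.Spec_iff (P := @LocallyOfFiniteType)]
  exact RingHom.FiniteType.comp (RingHom.finiteType_algebraMap.mpr (inferInstance : Algebra.FiniteType ℤ P))
    (RingHom.FiniteType.of_surjective _ ULift.ringEquiv.surjective)

end Chart

variable (k : ℕ) (M : Type u) [AddCommGroup M] {J : Type u}
variable [(grassmannianSheaf M k).obj.IsRepresentable]

/-- **THE GRASSMANNIAN SCHEME IS LOCALLY OF FINITE TYPE OVER `ℤ`** (basis form, `J` finite): the structure morphism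
`grassmannianScheme M k ⟶ Spec (ULift ℤ)` to the terminal scheme is locally of finite type — checked on the standard open cover by the
affine spaces `Spec ℤ[X_I]` (★ `chartOpenCover`; «locally of finite type» is Zariski-local on the source).
[cite: StacksProject, Tag 089T] [cite: GortzWedhorn2020, (8.4), Cor. 8.15] -/
theorem locallyOfFiniteType_grassmannianScheme [Finite J] (b : Module.Basis J ℤ M) :
    LocallyOfFiniteType (specULiftZIsTerminal.from (grassmannianScheme M k)) := by
  rw [IsZariskiLocalAtSource.iff_of_openCover (P := @LocallyOfFiniteType) (chartOpenCover k M b)]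
  intro I
  exact locallyOfFiniteType_to_specULiftZ_chartScheme k I.1 _

/-- **THE GRASSMANNIAN SCHEME OF A FINITE FREE ABELIAN GROUP IS LOCALLY OF FINITE TYPE OVER `ℤ`** (under the representability
instance, ★ `isRepresentable_grassmannianSheaf`). [cite: StacksProject, Tag 089T] [cite: GortzWedhorn2020, (8.4), Cor. 8.15] -/
theorem locallyOfFiniteType_grassmannianScheme_of_finite [Module.Free ℤ M] [Module.Finite ℤ M] :
    LocallyOfFiniteType (specULiftZIsTerminal.from (grassmannianScheme M k)) :=
  locallyOfFiniteType_grassmannianScheme k M (Module.Free.chooseBasis ℤ M)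

/-- **THE GRASSMANNIAN SCHEME IS QUASI-COMPACT** (basis form, `J` finite): finitely many charts `Spec ℤ[X_I]`, each affine hence
quasi-compact (Mathlib `Scheme.OpenCover.compactSpace`). [cite: StacksProject, Tag 089T] [cite: GortzWedhorn2020, (8.4), Cor. 8.15] -/
theorem compactSpace_grassmannianScheme [Finite J] (b : Module.Basis J ℤ M) : CompactSpace (grassmannianScheme M k) :=
  haveI : Finite (chartOpenCover k M b).I₀ := inferInstanceAs (Finite {I : Fin k → J // Function.Injective I})
  haveI : ∀ i, CompactSpace ((chartOpenCover k M b).X i) := fun i => inferInstanceAs (CompactSpace (chartScheme k i.1))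
  (chartOpenCover k M b).compactSpace

/-- **THE GRASSMANNIAN SCHEME OF A FINITE FREE ABELIAN GROUP IS QUASI-COMPACT** (hence, with `locallyOfFiniteType_…`, of finite type
over `ℤ`). [cite: StacksProject, Tag 089T] [cite: GortzWedhorn2020, (8.4), Cor. 8.15] -/
theorem compactSpace_grassmannianScheme_of_finite [Module.Free ℤ M] [Module.Finite ℤ M] : CompactSpace (grassmannianScheme M k) :=
  compactSpace_grassmannianScheme k M (Module.Free.chooseBasis ℤ M)

end Literature.AlgebraicGeometry.Motives.Grassmannian

end
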